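import Mathlib
import HarnessLib
import Literature.Combinatorics.Additive.StevensDeZeeuwIncidence
import Literature.Combinatorics.Extremal.KovariSosTuranTheorem

/-!
# The elementary `K₂,₂` bound for point–line incidences (Matoušek, Lemma 4.5.1)

J. Matoušek, *Lectures on Discrete Geometry* (GTM 212, Springer 2002) [Matousek2002], Chapter 4
"Incidence Problems", §4.5 "Point–Line Incidences via Cuttings", **Lemma 4.5.1** ("A worse but
useful bound", p. 64): for `m` points and `n` lines in the plane the number of incidences satisfies

  `I(m,n) = O(n√m + m)`  (4.2),   `I(m,n) = O(m√n + n)`  (4.3).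

Printed proof: two lines cross at most once, so a point with `dᵢ` incidences "consumes" `C(dᵢ,2)`
of the at most `C(n,2)` crossing pairs of lines, `Σᵢ C(dᵢ,2) ≤ C(n,2)`; then Cauchy–Schwarz. As the
book remarks right after the proof (pp. 64–65, "Forbidden subgraph arguments"), this is the
statement that the point–line incidence graph contains no `K₂,₂`, and the bound is the case
`r = s = 2` of the Kővári–Sós–Turán theorem (Theorem 4.5.2). We follow exactly this road, using the
tree's `Literature.Combinatorics.Extremal.kovari_sos_turan_choose` (for the printed counting
inequality) and `Literature.Combinatorics.Extremal.kovari_sos_turan` (for the bound, which comes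
out with all constants equal to `1`).

Setting: an ARBITRARY field `F` (the argument only uses that two points determine a line); points
`P ⊆ F²`; lines coded without repetition as in the tree's
`Literature.Combinatorics.Additive.LineIncident` — `inl (a, b)` is the line `y = a x + b`, `inr c`
the vertical line `x = c`; the incidences of `P` with a finite set of lines `L` are the pairs
`(p, ℓ) ∈ P × L` with `LineIncident p ℓ`.

PROVED here (theorems only, no definitions, no named facts):
* `lineIncident_unique` — two distinct points lie on at most one coded line;
* `not_K22` — the incidence graph on `↥P × ↥L` has no `2 × 2` clique;
* (private plumbing `card_graph_eq`, `card_graph_transpose_eq`, `card_degree_eq` — its edge count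
  is the number of incidences, its degrees are the `dᵢ`);
* **`sum_choose_two_degree_le`** — the printed counting step `Σ_{p ∈ P} C(d_p, 2) ≤ C(|L|, 2)`;
* **`card_incidences_le_lines_mul_sqrt`** — (4.2) with constant `1`: `I(P,L) ≤ |L|·√|P| + |P|`;
* **`card_incidences_le_points_mul_sqrt`** — (4.3) with constant `1`: `I(P,L) ≤ |P|·√|L| + |L|`;
* `card_incidences_le_min` — both together.

## References

* [Matousek2002] J. Matoušek, *Lectures on Discrete Geometry*, GTM 212, Springer (2002), §4.5,
  Lemma 4.5.1 and Theorem 4.5.2, pp. 64–65 (held text `galaxy-panama-431008558088267`, chunks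
  88–89).
* [KovariSosTuran1954] T. Kővári, V. T. Sós, P. Turán, *On a problem of K. Zarankiewicz*,
  Colloq. Math. 3 (1954) 50–57 (the tree file `KovariSosTuranTheorem.lean`).
-/

namespace Literature.Combinatorics.Extremal.PointLineIncidences

open Finset Literature.Combinatorics.Additive

variable {F : Type*} [Field F] [DecidableEq F]

/-! ### Two points determine a line: the incidence graph has no `K₂,₂` -/

omit [DecidableEq F] in
/-- Two distinct points of the affine plane `F²` lie on at most one coded line: if `p ≠ q` are both
incident with `ℓ` and with `ℓ'`, then `ℓ = ℓ'` ("two lines cross at most once").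
[cite: Matousek2002, §4.5, proof of Lemma 4.5.1 (p. 64)] -/
theorem lineIncident_unique {p q : F × F} (hpq : p ≠ q) {ℓ ℓ' : (F × F) ⊕ F}
    (hp : LineIncident p ℓ) (hq : LineIncident q ℓ) (hp' : LineIncident p ℓ')
    (hq' : LineIncident q ℓ') : ℓ = ℓ' := by
  rcases ℓ with ⟨a, b⟩ | c <;> rcases ℓ' with ⟨a', b'⟩ | c' <;>
    simp only [LineIncident] at hp hq hp' hq'
  · -- two non-vertical lines `y = a x + b`, `y = a' x + b'`
    by_cases ha : a = a'
    · subst ha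
      have hb : b = b' := add_left_cancel (hp.symm.trans hp')
      rw [hb]
    · exfalso
      have h1 : (a - a') * (p.1 - q.1) = 0 := by linear_combination -hp + hp' + hq - hq'
      rcases mul_eq_zero.mp h1 with h | h
      · exact ha (sub_eq_zero.mp h)
      · have hx : p.1 = q.1 := sub_eq_zero.mp h
        exact hpq (Prod.ext hx (by rw [hp, hq, hx]))
  · -- `ℓ` non-vertical, `ℓ'` vertical: both points have abscissa `c'`
    exfalso
    have hx : p.1 = q.1 := hp'.trans hq'.symm
    exact hpq (Prod.ext hx (by rw [hp, hq, hx]))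
  · -- `ℓ` vertical, `ℓ'` non-vertical
    exfalso
    have hx : p.1 = q.1 := hp.trans hq.symm
    exact hpq (Prod.ext hx (by rw [hp', hq', hx]))
  · -- two vertical lines through `p`
    rw [← hp, ← hp']

/-- **No `K₂,₂` in the incidence graph.** The bipartite incidence graph between the points `P` and
the lines `L` (edge `(p, ℓ)` iff `p` lies on `ℓ`) contains no `2 × 2` clique: two distinct points
and two distinct lines cannot be pairwise incident. [cite: Matousek2002, §4.5, remark after the
proof of Lemma 4.5.1 ("graphs with forbidden `K₂,₂`"), pp. 64–65] -/
theorem not_K22 (P : Finset (F × F)) (L : Finset ((F × F) ⊕ F)) :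
    ∀ (A : Finset P) (B : Finset L), A.card = 2 → B.card = 2 →
      ¬ A ×ˢ B ⊆ (univ.filter fun e : P × L => LineIncident e.1.1 e.2.1) := by
  intro A B hA hB hsub
  obtain ⟨x, x', hxx', rfl⟩ := card_eq_two.mp hA
  obtain ⟨y, y', hyy', rfl⟩ := card_eq_two.mp hB
  have h : ∀ u ∈ ({x, x'} : Finset P), ∀ v ∈ ({y, y'} : Finset L), LineIncident u.1 v.1 := by
    intro u hu v hv
    have huv : (u, v) ∈ ({x, x'} : Finset P) ×ˢ ({y, y'} : Finset L) := mem_product.mpr ⟨hu, hv⟩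
    exact (mem_filter.mp (hsub huv)).2
  have hne : (x : F × F) ≠ x' := fun e => hxx' (Subtype.ext e)
  exact hyy' (Subtype.ext (lineIncident_unique hne
    (h x (mem_insert_self _ _) y (mem_insert_self _ _))
    (h x' (mem_insert_of_mem (mem_singleton_self _)) y (mem_insert_self _ _))
    (h x (mem_insert_self _ _) y' (mem_insert_of_mem (mem_singleton_self _)))
    (h x' (mem_insert_of_mem (mem_singleton_self _)) y'
      (mem_insert_of_mem (mem_singleton_self _)))))

/-- The same for the transposed incidence graph (lines × points). [cite: Matousek2002, §4.5,
proof of Lemma 4.5.1 ("The other inequality … by looking at pairs of points on each line"), p. 64] -/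
theorem not_K22_transpose (P : Finset (F × F)) (L : Finset ((F × F) ⊕ F)) :
    ∀ (B : Finset L) (A : Finset P), B.card = 2 → A.card = 2 →
      ¬ B ×ˢ A ⊆ (univ.filter fun e : L × P => LineIncident e.2.1 e.1.1) := by
  intro B A hB hA hsub
  refine not_K22 P L A B hA hB fun e he => ?_
  have he' := mem_product.mp he
  have he'' : (e.2, e.1) ∈ B ×ˢ A := mem_product.mpr ⟨he'.2, he'.1⟩
  exact mem_filter.mpr ⟨mem_univ _, (mem_filter.mp (hsub he'')).2⟩

/-! ### The incidence graph counts incidences -/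

/-- The number of edges of the incidence graph on `↥P × ↥L` is the number of incidences
`I(P, L) = #{(p, ℓ) ∈ P × L : p ∈ ℓ}`. [folklore] -/
private theorem card_graph_eq (P : Finset (F × F)) (L : Finset ((F × F) ⊕ F)) :
    (univ.filter fun e : P × L => LineIncident e.1.1 e.2.1).card =
      ((P ×ˢ L).filter fun q => LineIncident q.1 q.2).card := by
  refine card_bij' (fun e _ => ((e.1 : F × F), (e.2 : (F × F) ⊕ F)))
    (fun q hq => (⟨q.1, (mem_product.mp (mem_filter.mp hq).1).1⟩,
      ⟨q.2, (mem_product.mp (mem_filter.mp hq).1).2⟩)) ?_ ?_ ?_ ?_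
  · intro e he
    exact mem_filter.mpr ⟨mem_product.mpr ⟨e.1.2, e.2.2⟩, (mem_filter.mp he).2⟩
  · intro q hq
    exact mem_filter.mpr ⟨mem_univ _, (mem_filter.mp hq).2⟩
  · intro e _
    rfl
  · intro q _
    rfl

/-- The transposed incidence graph on `↥L × ↥P` also has `I(P, L)` edges. [folklore] -/
private theorem card_graph_transpose_eq (P : Finset (F × F)) (L : Finset ((F × F) ⊕ F)) :
    (univ.filter fun e : L × P => LineIncident e.2.1 e.1.1).card =
      ((P ×ˢ L).filter fun q => LineIncident q.1 q.2).card := by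
  refine card_bij' (fun e _ => ((e.2 : F × F), (e.1 : (F × F) ⊕ F)))
    (fun q hq => (⟨q.2, (mem_product.mp (mem_filter.mp hq).1).2⟩,
      ⟨q.1, (mem_product.mp (mem_filter.mp hq).1).1⟩)) ?_ ?_ ?_ ?_
  · intro e he
    exact mem_filter.mpr ⟨mem_product.mpr ⟨e.2.2, e.1.2⟩, (mem_filter.mp he).2⟩
  · intro q hq
    exact mem_filter.mpr ⟨mem_univ _, (mem_filter.mp hq).2⟩
  · intro e _
    rfl
  · intro q _
    rfl

/-- The degree of a point `p ∈ P` in the incidence graph is the number `d_p` of lines of `L`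
through `p`. [folklore] -/
private theorem card_degree_eq (P : Finset (F × F)) (L : Finset ((F × F) ⊕ F)) (x : P) :
    (univ.filter fun y : L =>
        (x, y) ∈ (univ.filter fun e : P × L => LineIncident e.1.1 e.2.1)).card =
      (L.filter fun ℓ => LineIncident (x : F × F) ℓ).card := by
  refine card_bij' (fun y _ => (y : (F × F) ⊕ F)) (fun ℓ hℓ => ⟨ℓ, (mem_filter.mp hℓ).1⟩)
    ?_ ?_ ?_ ?_
  · intro y hy
    have := (mem_filter.mp (mem_filter.mp hy).2).2
    exact mem_filter.mpr ⟨y.2, this⟩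
  · intro ℓ hℓ
    exact mem_filter.mpr ⟨mem_univ _, mem_filter.mpr ⟨mem_univ _, (mem_filter.mp hℓ).2⟩⟩
  · intro y _
    rfl
  · intro ℓ _
    rfl

/-! ### Lemma 4.5.1 -/

/-- **The printed counting step of Lemma 4.5.1**: with `d_p` the number of lines of `L` through
`p`, `Σ_{p ∈ P} C(d_p, 2) ≤ C(n, 2)`, `n = |L|` — each point with `d_p` incidences consumes
`C(d_p, 2)` of the at most `C(n, 2)` crossing pairs of lines. (Obtained from the counting core of
the Kővári–Sós–Turán theorem with `s = t = 2`.) [cite: Matousek2002, §4.5, proof of Lemma 4.5.1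
("Therefore `Σᵢ C(dᵢ,2) ≤ C(n,2)`"), p. 64] -/
theorem sum_choose_two_degree_le (P : Finset (F × F)) (L : Finset ((F × F) ⊕ F)) :
    ∑ p ∈ P, (L.filter fun ℓ => LineIncident p ℓ).card.choose 2 ≤ L.card.choose 2 := by
  have h := kovari_sos_turan_choose (univ.filter fun e : P × L => LineIncident e.1.1 e.2.1) 2 2
    (by norm_num) (not_K22 P L)
  rw [Fintype.card_coe, show 2 - 1 = 1 from rfl, one_mul] at h
  calc ∑ p ∈ P, (L.filter fun ℓ => LineIncident p ℓ).card.choose 2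
      = ∑ x : P, (L.filter fun ℓ => LineIncident (x : F × F) ℓ).card.choose 2 :=
        (sum_coe_sort P (fun p => (L.filter fun ℓ => LineIncident p ℓ).card.choose 2)).symm
    _ = ∑ x : P, (univ.filter fun y : L =>
          (x, y) ∈ (univ.filter fun e : P × L => LineIncident e.1.1 e.2.1)).card.choose 2 := by
        refine sum_congr rfl fun x _ => ?_
        rw [card_degree_eq]
    _ ≤ L.card.choose 2 := h

/-- **Lemma 4.5.1, (4.2), with explicit constant**: for a finite set `P` of `m` points and a finite
set `L` of `n` (distinct) lines of the affine plane over any field,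
`I(P, L) ≤ n·√m + m`. (The case `r = s = 2` of the Kővári–Sós–Turán theorem, Theorem 4.5.2, applied
to the `K₂,₂`-free incidence graph.) [cite: Matousek2002, §4.5, Lemma 4.5.1 (4.2), p. 64] -/
theorem card_incidences_le_lines_mul_sqrt (P : Finset (F × F)) (L : Finset ((F × F) ⊕ F)) :
    (((P ×ˢ L).filter fun q => LineIncident q.1 q.2).card : ℝ) ≤
      (L.card : ℝ) * Real.sqrt P.card + P.card := by
  have h := kovari_sos_turan (univ.filter fun e : P × L => LineIncident e.1.1 e.2.1) 2 2
    (by norm_num) (by norm_num) (not_K22 P L)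
  rw [card_graph_eq, Fintype.card_coe, Fintype.card_coe] at h
  simp only [Nat.cast_ofNat] at h
  rw [show (2 : ℝ) - 1 = 1 by norm_num, Real.one_rpow, one_mul, one_mul,
    show (1 : ℝ) - 1 / 2 = 1 / 2 by norm_num, ← Real.sqrt_eq_rpow] at h
  exact h

/-- **Lemma 4.5.1, (4.3), with explicit constant**: `I(P, L) ≤ m·√n + n` for `m` points and `n`
lines (the Kővári–Sós–Turán bound for the transposed, equally `K₂,₂`-free, incidence graph — "by
looking at pairs of points on each line"). [cite: Matousek2002, §4.5, Lemma 4.5.1 (4.3), p. 64] -/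
theorem card_incidences_le_points_mul_sqrt (P : Finset (F × F)) (L : Finset ((F × F) ⊕ F)) :
    (((P ×ˢ L).filter fun q => LineIncident q.1 q.2).card : ℝ) ≤
      (P.card : ℝ) * Real.sqrt L.card + L.card := by
  have h := kovari_sos_turan (univ.filter fun e : L × P => LineIncident e.2.1 e.1.1) 2 2
    (by norm_num) (by norm_num) (not_K22_transpose P L)
  rw [card_graph_transpose_eq, Fintype.card_coe, Fintype.card_coe] at h
  simp only [Nat.cast_ofNat] at h
  rw [show (2 : ℝ) - 1 = 1 by norm_num, Real.one_rpow, one_mul, one_mul,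
    show (1 : ℝ) - 1 / 2 = 1 / 2 by norm_num, ← Real.sqrt_eq_rpow] at h
  exact h

/-- **Lemma 4.5.1** (both bounds): `I(P, L) ≤ min(n√m + m, m√n + n)` for `m = |P|` points and
`n = |L|` lines. [cite: Matousek2002, §4.5, Lemma 4.5.1, p. 64] -/
theorem card_incidences_le_min (P : Finset (F × F)) (L : Finset ((F × F) ⊕ F)) :
    (((P ×ˢ L).filter fun q => LineIncident q.1 q.2).card : ℝ) ≤
      min ((L.card : ℝ) * Real.sqrt P.card + P.card) ((P.card : ℝ) * Real.sqrt L.card + L.card) :=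
  le_min (card_incidences_le_lines_mul_sqrt P L) (card_incidences_le_points_mul_sqrt P L)

/-- **Lemma 4.5.1 in the `I(m,n)` form**: if `|P| = m` and `|L| = n` then
`I(P, L) ≤ n√m + m` and `I(P, L) ≤ m√n + n`. [cite: Matousek2002, §4.5, Lemma 4.5.1 (4.2)–(4.3),
p. 64] -/
theorem incidences_le (P : Finset (F × F)) (L : Finset ((F × F) ⊕ F)) {m n : ℕ}
    (hP : P.card = m) (hL : L.card = n) :
    (((P ×ˢ L).filter fun q => LineIncident q.1 q.2).card : ℝ) ≤ n * Real.sqrt m + m ∧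
      (((P ×ˢ L).filter fun q => LineIncident q.1 q.2).card : ℝ) ≤ m * Real.sqrt n + n := by
  subst hP hL
  exact ⟨card_incidences_le_lines_mul_sqrt P L, card_incidences_le_points_mul_sqrt P L⟩

end Literature.Combinatorics.Extremal.PointLineIncidences
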